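import Literature.Probability.RandomPlanarGeometry.SlitLanding
import Literature.Probability.RandomPlanarGeometry.HullSubordination
import HarnessLib

/-!
# The intermediate hulls `g_s(γ(s, t])` of a slit and the continuity of the driving function

G. F. Lawler, *Conformally Invariant Processes in the Plane*, AMS (2005), §4.1, p. 94: "For
`s > 0`, let `γ^s(t) = g_s(γ(s + t))` … Let `g_{s,t} = g_{γ^s(0, t-s]}` so that
`g_t = g_{s,t} ∘ g_s`", Lemma 4.1 — "`‖g_s - g_t‖_∞ ≤ c √(diam(γ[0,t₀]) osc(γ, t - s, t₀))`" (from
(3.21) and (3.12)) — and Lemma 4.2 — "`t ↦ U_t` is continuous". In the normalization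
`Φ_t = Φ_{γ[0,t]}` of Lawler–Schramm–Werner (2003), p. 13, for the tree's reflected maps
`E_u = IsPlusSlit.ext u` (`SlitLanding`), this file PROVES:

* `IsPlusSlit.incr u v` — **the intermediate hull `B_{u,v} = cl E_u(γ(u, v])`**, which is the
  quotient hull `cl Φ_{γ[0,u]}((γ[0,v] ∖ γ[0,u]) ∩ ℍ)` of `HullSubordination`
  (`incr_eq_quotientHull`), hence a `*`-hull with `γ[0,v] = B_{u,v} · γ[0,u]`
  (`isHullProduct_incr`); its only real point is the tip image `Ũ_u` (`eq_landing_of_mem_incr`),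
  so **`B_{u,v} ∈ 𝒬₊`** (`isPlusHull_incr`), and `B_{u,v} ⊆ B̄(Ũ_u, ρ)` as soon as
  `|E_u(γ t) - Ũ_u| ≤ ρ` on `(u, v]` (`incr_subset_closedBall`);
* `IsPlusSlit.ext_eq_extMap_incr` — **`E_v = E_{B_{u,v}} ∘ E_u` on `ℍ ∖ γ[0, v]`**
  (`Φ_{B·A'} = Φ_B ∘ Φ_{A'}` and uniqueness of restriction maps);
* `IsPlusSlit.norm_ext_sub_ext_le_of_growth` — **Lawler's Lemma 4.1, second display:
  `‖E_v - E_u‖ ≤ 12ρ` on `ℍ ∖ γ[0, v]`** (the displacement bound (3.12) of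
  `PlusHullDisplacement` for `B_{u,v} ⊆ B̄(Ũ_u, ρ)`);
* `IsPlusSlit.norm_landing_sub_landing_le`, `IsPlusSlit.uniformContinuous_landing` — **Lemma 4.2:
  `|Ũ_v - Ũ_u| ≤ 13ρ`, so `u ↦ Ũ_u` is uniformly continuous on `(0, 1)`** (with the uniform
  local growth of `SlitLanding`).

## References

* G. F. Lawler (2005), §4.1, Lemma 4.1, Lemma 4.2 [Lawler2005].
* [LSW] §2 p. 8 (`A = A₁ · A₂`), proof of Lemma 3.5 p. 13 [LawlerSchrammWerner2003Restriction].
-/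

noncomputable section

open Set Filter Metric Complex Bornology Function
open _root_.Topology
open UpperHalfPlane (upperHalfPlaneSet isOpen_upperHalfPlaneSet)
open scoped ComplexConjugate

namespace Literature.Probability.RandomPlanarGeometry

/-- **`Φ_X = Φ_B ∘ Φ_{A'}` for `X = B · A'`**, for EVERY restriction map `Ψ` of `X` and every
restriction map `Φ_B` of `B` (the product map is a restriction map of the product hull,
`IsRestrictionMap.hullProduct`, and restriction maps are unique; transported along
`hullProduct B A' Φ' = X`). [cite: LawlerSchrammWerner2003Restriction, §2 p. 8 (Φ_{A·A'} = Φ_A ∘ Φ_{A'})] -/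
theorem IsStarHull.eqOn_comp_of_hullProduct_eq {X B A' : Set ℂ} (hX : IsStarHull X)
    (Ψ : ConformalEquiv (upperHalfPlaneSet \ X) upperHalfPlaneSet) (hΨ : IsRestrictionMap X Ψ)
    (hB : IsStarHull B) (hA' : IsStarHull A')
    {ΦB : ConformalEquiv (upperHalfPlaneSet \ B) upperHalfPlaneSet} (hΦB : IsRestrictionMap B ΦB)
    {Φ' : ConformalEquiv (upperHalfPlaneSet \ A') upperHalfPlaneSet} (hΦ' : IsRestrictionMap A' Φ')
    (hP : _root_.Literature.Probability.RandomPlanarGeometry.hullProduct B A' Φ' = X) :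
    EqOn Ψ (fun z ↦ ΦB (Φ' z)) (upperHalfPlaneSet \ X) := by
  subst hP
  have hmap := hΦB.hullProduct hB.isBoundedHull.isClosed hA'.isBoundedHull.isClosed hΦ'
  obtain ⟨Φ₀, -, huniq⟩ := IsStarHull.existsUnique_isRestrictionMap_holds hX
  intro z hz
  rw [huniq Ψ hΨ hz, ← huniq _ hmap hz, hullProductMap_apply]

namespace IsPlusSlit

variable {γ : ℝ → ℂ} (h : IsPlusSlit γ)

/-! ### The intermediate hull `B_{u,v}` -/

/-- **The intermediate hull `B_{u,v} = cl E_u(γ(u, v])`** (Lawler's `γ^s(0, t - s]`, closed up by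
its base point `Ũ_u`). [cite: Lawler2005, §4.1 (the maps g_{s,t})] -/
def incr (u v : ℝ) : Set ℂ := closure (h.ext u '' (γ '' Ioc u v))

/-- `(γ[0, v] ∖ γ[0, u]) ∩ ℍ = γ(u, v]` for `0 ≤ u ≤ v ≤ 1`. [folklore] -/
theorem hull_diff_hull_inter {u v : ℝ} (hu : 0 ≤ u) (hv1 : v ≤ 1) :
    (h.hull v \ h.hull u) ∩ upperHalfPlaneSet = γ '' Ioc u v := by
  ext z
  constructor
  · rintro ⟨⟨⟨t, ht, rfl⟩, hzu⟩, hzH⟩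
    refine ⟨t, ⟨lt_of_not_ge fun htu ↦ hzu ⟨t, ⟨ht.1, htu⟩, rfl⟩, ht.2⟩, rfl⟩
  · rintro ⟨t, ht, rfl⟩
    have hmem := h.apply_mem_diff hu ht.1 (ht.2.trans hv1)
    exact ⟨⟨⟨t, ⟨hu.trans ht.1.le, ht.2⟩, rfl⟩, hmem.2⟩, hmem.1⟩

/-- **`B_{u,v}` is the quotient hull** `cl Φ'((γ[0,v] ∖ γ[0,u]) ∩ ℍ)` for every restriction map
`Φ'` of `γ[0, u]` (they all agree with `E_u` on `ℍ ∖ γ[0, u]`). [folklore] -/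
theorem incr_eq_quotientHull {u v : ℝ} (hu0 : 0 < u) (huv : u ≤ v) (hv1 : v ≤ 1)
    {Φ' : ConformalEquiv (upperHalfPlaneSet \ h.hull u) upperHalfPlaneSet}
    (hΦ' : IsRestrictionMap (h.hull u) Φ') : quotientHull (h.hull v) (h.hull u) Φ' = h.incr u v := by
  have hu1 : u ≤ 1 := huv.trans hv1
  rw [quotientHull, incr, h.hull_diff_hull_inter hu0.le hv1]
  congr 1
  refine image_congr fun z hz ↦ ?_
  have hzU : z ∈ upperHalfPlaneSet \ h.hull u := h.image_Ioc_subset_diff hu0.le hv1 hz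
  rw [h.ext_eq hu0 hu1, (h.isPlusHull hu0 hu1).extMap_of_mem_diff (h.hull_nonempty hu0.le) hzU,
    (h.isPlusHull hu0 hu1).eqOn_baseMap (h.hull_nonempty hu0.le) hΦ' hzU]

/-- **`B_{u,v}` is a `*`-hull and `γ[0, v] = B_{u,v} · γ[0, u]`.** [cite: LawlerSchrammWerner2003Restriction, §2 p. 8 (Semigroups)] -/
theorem isStarHull_incr_and {u v : ℝ} (hu0 : 0 < u) (huv : u ≤ v) (hv1 : v ≤ 1) :
    IsStarHull (h.incr u v) ∧ RestrictionConfig.IsHullProduct (h.incr u v) (h.hull u) (h.hull v) := by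
  have hu1 : u ≤ 1 := huv.trans hv1
  have hA : IsStarHull (h.hull v) := (h.isPlusHull (hu0.trans_le huv) hv1).1
  have hA' : IsStarHull (h.hull u) := (h.isPlusHull hu0 hu1).1
  obtain ⟨Φ', hΦ', h0, hinf, -⟩ := hA'.exists_restrictionMap_tendsto
  have hsub : h.hull u ⊆ h.hull v := h.hull_mono huv
  have heq := h.incr_eq_quotientHull hu0 huv hv1 hΦ'
  refine ⟨heq ▸ hA.isStarHull_quotientHull hsub h0 hinf, heq ▸ ?_⟩
  exact ⟨hA, Φ', hΦ', hA.diff_eq_setOf_quotientHull hsub⟩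

/-- `B_{u,v} ∈ 𝒬*`. [folklore] -/
theorem isStarHull_incr {u v : ℝ} (hu0 : 0 < u) (huv : u ≤ v) (hv1 : v ≤ 1) : IsStarHull (h.incr u v) :=
  (h.isStarHull_incr_and hu0 huv hv1).1

/-- `γ[0, v] = B_{u,v} · γ[0, u]`. [folklore] -/
theorem isHullProduct_incr {u v : ℝ} (hu0 : 0 < u) (huv : u ≤ v) (hv1 : v ≤ 1) :
    RestrictionConfig.IsHullProduct (h.incr u v) (h.hull u) (h.hull v) :=
  (h.isStarHull_incr_and hu0 huv hv1).2

/-- `E_u(γ(v)) ∈ B_{u,v}` (`u < v`): the intermediate hull is nonempty. [folklore] -/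
theorem ext_apply_mem_incr {u v : ℝ} (huv : u < v) : h.ext u (γ v) ∈ h.incr u v :=
  subset_closure ⟨γ v, ⟨v, ⟨huv, le_rfl⟩, rfl⟩, rfl⟩

/-- `B_{u,v}` is nonempty for `u < v`. [folklore] -/
theorem incr_nonempty {u v : ℝ} (huv : u < v) : (h.incr u v).Nonempty := ⟨_, h.ext_apply_mem_incr huv⟩

/-- **The only real point of `B_{u,v}` is `Ũ_u`**: a real limit of points `E_u(γ(t_k))`,
`t_k ∈ (u, v]`, has `t_k → u` (at an interior limit time the map is continuous with value in
`ℍ`), so it is the tip image. [folklore] -/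
theorem eq_landing_of_mem_incr {u v : ℝ} (hu0 : 0 < u) (hu1 : u < 1) (hv1 : v ≤ 1) {w : ℂ}
    (hw : w ∈ h.incr u v) (hwim : w.im = 0) : w = h.landing u := by
  rcases le_or_gt v u with hvu | huv
  · -- empty arc
    simp [incr, Ioc_eq_empty_of_le hvu] at hw
  have hA : IsPlusHull (h.hull u) := h.isPlusHull hu0 hu1.le
  have hne : (h.hull u).Nonempty := h.hull_nonempty hu0.le
  rw [incr, mem_closure_iff_seq_limit] at hw
  obtain ⟨x, hx, hxlim⟩ := hw
  choose z hz hzx using hx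
  choose t ht htz using hz
  -- a convergent subsequence of the times `t n ∈ [u, v]`
  obtain ⟨ts, hts, φ, hφ, htlim⟩ := isCompact_Icc.tendsto_subseq (x := t) fun n ↦ ⟨(ht n).1.le, (ht n).2⟩
  have hxφ : Tendsto (x ∘ φ) atTop (𝓝 w) := hxlim.comp hφ.tendsto_atTop
  have hxeq : ∀ n, x (φ n) = h.ext u (γ (t (φ n))) := fun n ↦ by rw [← hzx, ← htz]
  rcases hts.1.eq_or_lt with heq | hlt
  · -- `t (φ n) → u` from above: the values tend to the tip image
    have htu : Tendsto (t ∘ φ) atTop (𝓝[>] u) :=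
      tendsto_nhdsWithin_iff.2 ⟨heq ▸ htlim, Eventually.of_forall fun n ↦ (ht (φ n)).1⟩
    have h1 : Tendsto (x ∘ φ) atTop (𝓝 (h.landing u)) :=
      ((h.tendsto_landing hu0 hu1).comp htu).congr fun n ↦ (hxeq n).symm
    exact tendsto_nhds_unique hxφ h1
  · -- an interior limit time: the limit is a value of `E_u` in `ℍ`
    exfalso
    have hts1 : ts ≤ 1 := hts.2.trans hv1
    have hmem : γ ts ∈ upperHalfPlaneSet \ h.hull u := h.apply_mem_diff hu0.le hlt hts1
    have hγc : Tendsto (fun n ↦ γ (t (φ n))) atTop (𝓝 (γ ts)) := by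
      have hc : ContinuousWithinAt γ (Icc 0 1) ts := h.continuousOn ts ⟨hu0.le.trans hts.1, hts1⟩
      refine hc.tendsto.comp (tendsto_nhdsWithin_iff.2 ⟨htlim, Eventually.of_forall fun n ↦ ?_⟩)
      exact ⟨hu0.le.trans (ht (φ n)).1.le, (ht (φ n)).2.trans hv1⟩
    have hEc : ContinuousAt (h.ext u) (γ ts) := by
      rw [h.ext_eq hu0 hu1.le]
      exact (hA.differentiableAt_extMap hne (hA.diff_subset_plusDomain hmem)).continuousAt
    have h1 : Tendsto (x ∘ φ) atTop (𝓝 (h.ext u (γ ts))) :=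
      (hEc.tendsto.comp hγc).congr fun n ↦ (hxeq n).symm
    have hw : w = h.ext u (γ ts) := tendsto_nhds_unique hxφ h1
    have hpos : 0 < (h.ext u (γ ts)).im := by
      rw [h.ext_eq hu0 hu1.le]; exact hA.extMap_mem_of_mem_diff hne hmem
    rw [← hw, hwim] at hpos
    exact lt_irrefl 0 hpos

/-- **`B_{u,v} ∈ 𝒬₊`** for `0 < u < v ≤ 1`, `u < 1`: its real points are the positive number
`Ũ_u`. [cite: Lawler2005, §4.1 (the maps g_{s,t})] -/
theorem isPlusHull_incr {u v : ℝ} (hu0 : 0 < u) (hu1 : u < 1) (huv : u ≤ v) (hv1 : v ≤ 1) :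
    IsPlusHull (h.incr u v) := by
  refine ⟨h.isStarHull_incr hu0 huv hv1, fun x hx ↦ ?_⟩
  have heq := h.eq_landing_of_mem_incr hu0 hu1 hv1 hx (ofReal_im x)
  have : x = (h.landing u).re := by rw [← heq, ofReal_re]
  rw [this]
  exact h.landing_re_pos hu0 hu1

/-- `B_{u,v} ⊆ B̄(Ũ_u, ρ)` as soon as `|E_u(γ t) - Ũ_u| ≤ ρ` on `(u, v]`. [folklore] -/
theorem incr_subset_closedBall {u v ρ : ℝ} (hu0 : 0 < u) (hu1 : u < 1)
    (hgrowth : ∀ t ∈ Ioc u v, ‖h.ext u (γ t) - h.landing u‖ ≤ ρ) :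
    h.incr u v ⊆ closedBall ((((h.landing u).re : ℝ)) : ℂ) ρ := by
  rw [← h.landing_eq_ofReal hu0 hu1]
  refine closure_minimal ?_ isClosed_closedBall
  rintro _ ⟨_, ⟨t, ht, rfl⟩, rfl⟩
  rw [mem_closedBall, dist_eq_norm]
  exact hgrowth t ht

/-! ### `E_v = E_{B_{u,v}} ∘ E_u` and Lawler's Lemma 4.1 -/

/-- **`E_v = E_{B_{u,v}} ∘ E_u` on `ℍ ∖ γ[0, v]`** (`γ[0,v] = B_{u,v} · γ[0,u]`,
`Φ_{B·A'} = Φ_B ∘ Φ_{A'}`, uniqueness of restriction maps). [cite: Lawler2005, §4.1 (g_t = g_{s,t} ∘ g_s)] -/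
theorem ext_eq_extMap_incr {u v : ℝ} (hu0 : 0 < u) (hu1 : u < 1) (huv : u < v) (hv1 : v ≤ 1)
    {z : ℂ} (hz : z ∈ upperHalfPlaneSet \ h.hull v) :
    h.ext v z = (h.isPlusHull_incr hu0 hu1 huv.le hv1).extMap (h.incr_nonempty huv) (h.ext u z) := by
  have hv0 : 0 < v := hu0.trans huv
  have hAv : IsPlusHull (h.hull v) := h.isPlusHull hv0 hv1
  have hAu : IsPlusHull (h.hull u) := h.isPlusHull hu0 hu1.le
  have hB : IsPlusHull (h.incr u v) := h.isPlusHull_incr hu0 hu1 huv.le hv1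
  have hneB : (h.incr u v).Nonempty := h.incr_nonempty huv
  have hzu : z ∈ upperHalfPlaneSet \ h.hull u := ⟨hz.1, fun h' ↦ hz.2 (h.hull_mono huv.le h')⟩
  -- `hullProduct B (hull u) Φ_u = hull v`
  have hprod := h.isHullProduct_incr hu0 huv.le hv1
  have hP := hprod.hullProduct_eq hAu.1 hB.1 (hAu.isRestrictionMap_baseMap (h.hull_nonempty hu0.le))
  have key := hAv.1.eqOn_comp_of_hullProduct_eq (hAv.baseMap (h.hull_nonempty hv0.le))
    (hAv.isRestrictionMap_baseMap (h.hull_nonempty hv0.le)) hB.1 hAu.1 (hB.isRestrictionMap_baseMap hneB)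
    (hAu.isRestrictionMap_baseMap (h.hull_nonempty hu0.le)) hP hz
  -- unfold the `E`'s
  have hw : h.ext u z ∈ upperHalfPlaneSet \ h.incr u v := by
    rw [h.ext_eq hu0 hu1.le, hAu.extMap_of_mem_diff (h.hull_nonempty hu0.le) hzu,
      ← h.incr_eq_quotientHull hu0 huv.le hv1 (hAu.isRestrictionMap_baseMap (h.hull_nonempty hu0.le)),
      hAv.1.diff_quotientHull (h.hull_mono huv.le)]
    exact ⟨z, hz, rfl⟩
  rw [h.ext_eq hv0 hv1, hAv.extMap_of_mem_diff (h.hull_nonempty hv0.le) hz, hB.extMap_of_mem_diff hneB hw]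
  simp only at key
  rw [key, h.ext_eq hu0 hu1.le, hAu.extMap_of_mem_diff (h.hull_nonempty hu0.le) hzu]

/-- `E_u(z) ∈ ℍ ∖ B_{u,v}` for `z ∈ ℍ ∖ γ[0, v]`. [folklore] -/
theorem ext_mem_diff_incr {u v : ℝ} (hu0 : 0 < u) (hu1 : u ≤ 1) (huv : u ≤ v) (hv1 : v ≤ 1)
    {z : ℂ} (hz : z ∈ upperHalfPlaneSet \ h.hull v) : h.ext u z ∈ upperHalfPlaneSet \ h.incr u v := by
  have hAu : IsPlusHull (h.hull u) := h.isPlusHull hu0 hu1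
  have hzu : z ∈ upperHalfPlaneSet \ h.hull u := ⟨hz.1, fun h' ↦ hz.2 (h.hull_mono huv h')⟩
  rw [h.ext_eq hu0 hu1, hAu.extMap_of_mem_diff (h.hull_nonempty hu0.le) hzu,
    ← h.incr_eq_quotientHull hu0 huv hv1 (hAu.isRestrictionMap_baseMap (h.hull_nonempty hu0.le)),
    (h.isPlusHull (hu0.trans_le huv) hv1).1.diff_quotientHull (h.hull_mono huv)]
  exact ⟨z, hz, rfl⟩

/-- **Lawler's Lemma 4.1, second display: `‖E_v - E_u‖ ≤ 12ρ` on `ℍ ∖ γ[0, v]`** whenever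
`|E_u(γ t) - Ũ_u| ≤ ρ` on `(u, v]` (the displacement bound (3.12) for `B_{u,v} ⊆ B̄(Ũ_u, ρ)`).
[cite: Lawler2005, Lemma 4.1] -/
theorem norm_ext_sub_ext_le_of_growth {u v : ℝ} (hu0 : 0 < u) (hu1 : u < 1) (huv : u < v) (hv1 : v ≤ 1)
    {ρ : ℝ} (hρ : 0 < ρ) (hgrowth : ∀ t ∈ Ioc u v, ‖h.ext u (γ t) - h.landing u‖ ≤ ρ)
    {z : ℂ} (hz : z ∈ upperHalfPlaneSet \ h.hull v) : ‖h.ext v z - h.ext u z‖ ≤ 12 * ρ := by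
  have hB : IsPlusHull (h.incr u v) := h.isPlusHull_incr hu0 hu1 huv.le hv1
  rw [h.ext_eq_extMap_incr hu0 hu1 huv hv1 hz]
  exact hB.norm_extMap_sub_self_le (h.incr_nonempty huv) hρ (h.incr_subset_closedBall hu0 hu1 hgrowth)
    (hB.diff_subset_plusDomain (h.ext_mem_diff_incr hu0 hu1.le huv.le hv1 hz))

/-! ### Continuity of the driving function (Lawler's Lemma 4.2) -/

/-- **`|Ũ_v - Ũ_u| ≤ 13ρ`** when `|E_u(γ t) - Ũ_u| ≤ ρ` on `(u, v']`, `u < v < v' ≤ 1`: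
`Ũ_v = lim_{t ↓ v} E_v(γ t)` with `|E_v(γ t) - E_u(γ t)| ≤ 12ρ` and `|E_u(γ t) - Ũ_u| ≤ ρ`.
[cite: Lawler2005, Lemma 4.2] -/
theorem norm_landing_sub_landing_le {u v v' : ℝ} (hu0 : 0 < u) (huv : u < v) (hvv' : v < v')
    (hv'1 : v' ≤ 1) {ρ : ℝ} (hρ : 0 < ρ)
    (hgrowth : ∀ t ∈ Ioc u v', ‖h.ext u (γ t) - h.landing u‖ ≤ ρ) :
    ‖h.landing v - h.landing u‖ ≤ 13 * ρ := by
  have hv1 : v < 1 := hvv'.trans_le hv'1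
  have hu1 : u < 1 := huv.trans hv1
  have hlim : Tendsto (fun t ↦ ‖h.ext v (γ t) - h.landing u‖) (𝓝[>] v) (𝓝 ‖h.landing v - h.landing u‖) :=
    ((h.tendsto_landing (hu0.trans huv) hv1).sub_const _).norm
  refine le_of_tendsto hlim ?_
  filter_upwards [Ioc_mem_nhdsGT hvv'] with t ht
  have ht1 : t ≤ 1 := ht.2.trans hv'1
  have hmem : γ t ∈ upperHalfPlaneSet \ h.hull v := h.apply_mem_diff (hu0.trans huv).le ht.1 ht1
  have h2 := h.norm_ext_sub_ext_le_of_growth hu0 hu1 huv hv1.le hρ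
    (fun s hs ↦ hgrowth s ⟨hs.1, hs.2.trans hvv'.le⟩) hmem
  have h3 := hgrowth t ⟨huv.trans ht.1, ht.2⟩
  calc ‖h.ext v (γ t) - h.landing u‖ = ‖(h.ext v (γ t) - h.ext u (γ t)) + (h.ext u (γ t) - h.landing u)‖ := by
        ring_nf
    _ ≤ ‖h.ext v (γ t) - h.ext u (γ t)‖ + ‖h.ext u (γ t) - h.landing u‖ := norm_add_le _ _
    _ ≤ 12 * ρ + ρ := add_le_add h2 h3
    _ = 13 * ρ := by ring

/-- **Lawler's Lemma 4.2: `u ↦ Ũ_u` is uniformly continuous on `(0, 1)`**: for every `ε > 0`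
there is `δ > 0` with `|Ũ_v - Ũ_u| ≤ ε` whenever `0 < u < v < 1`, `v < u + δ` (uniform local
growth of `SlitLanding` and the previous lemma). [cite: Lawler2005, Lemma 4.2] -/
theorem uniformContinuous_landing {ε : ℝ} (hε : 0 < ε) :
    ∃ δ : ℝ, 0 < δ ∧ ∀ u v : ℝ, 0 < u → u < v → v < 1 → v < u + δ → ‖h.landing v - h.landing u‖ ≤ ε := by
  obtain ⟨δ₀, hδ₀, hgrowth⟩ := h.uniform_local_growth (show 0 < ε / 13 by positivity)
  refine ⟨δ₀ / 2, half_pos hδ₀, fun u v hu0 huv hv1 hvδ ↦ ?_⟩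
  -- an auxiliary time `v < v' ≤ 1` with `v' < u + δ₀`
  set v' : ℝ := (v + min (u + δ₀) 1) / 2 with hv'
  have hvm : v < min (u + δ₀) 1 := lt_min (by linarith) hv1
  have hvv' : v < v' := by rw [hv']; linarith
  have hv'm : v' < min (u + δ₀) 1 := by rw [hv']; linarith
  have hv'1 : v' ≤ 1 := (hv'm.trans_le (min_le_right _ _)).le
  have hv'δ : v' < u + δ₀ := hv'm.trans_le (min_le_left _ _)
  have key := h.norm_landing_sub_landing_le hu0 huv hvv' hv'1 (show 0 < ε / 13 by positivity)
    fun t ht ↦ hgrowth u hu0 (huv.trans hv1) t ht.1 (ht.2.trans hv'1) (lt_of_le_of_lt ht.2 hv'δ)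
  linarith

end IsPlusSlit

end Literature.Probability.RandomPlanarGeometry
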